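import Literature.NumberTheory.ComplexMultiplication.CMOrderCohenMacaulayTypeAttained
import HarnessLib

/-!
# The global Cohen–Macaulay type of an order: `type(S) = max_𝔭 type_𝔭(S)` (MARSEGLIA 2024 DEFINITION 3.2 (ii)),
# COROLLARY 3.6 = MAIN THEOREM 1 (2) «`S ≠ 𝒪_K ⟹ type(S) + 1 = max_𝔭 dim_{S/𝔭} (𝔭:𝔭)/𝔭`», and MAIN THEOREM 1 (3)
# in global form

Family `hodge`, lane `lit-hodgefound` (Track 2 foundations library; seat p15, row g28-#4), topic
`Literature/NumberTheory/ComplexMultiplication`, namespace `Literature.NumberTheory.ComplexMultiplication.CMTypeLattice`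
(the order `𝔯 = endOrder (M_μ)` of a `ℚ`-basis `μ` of a number field `K` of degree `#ι = [K:ℚ]`; the local type
`type_𝔭(𝔯) = dim_{𝔯/𝔭} 𝔯ᵗ/𝔭𝔯ᵗ = finrank (𝔯 ⧸ 𝔭) (↥↑T ⧸ 𝔭 • ⊤)` with `↑T = traceDual ℤ ℚ ↑1` of
`CMOrderCohenMacaulayTypeOne`; the multiplicator ring `(𝔭:𝔭) = ↑𝔭/↑𝔭` and the `𝔯/𝔭`-space `(𝔭:𝔭)/𝔭 = (𝔭:𝔭)/𝔭(𝔭:𝔭)`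
presented as `↥↑(↑𝔭/↑𝔭) ⧸ 𝔭 • ⊤` exactly as in `CMOrderCohenMacaulayTypeBound` (`𝔭(𝔭:𝔭) = 𝔭`,
`NumberRing.mul_div_self_eq_self`); «`𝔭` invertible» is `IsUnit (↑𝔭 : FractionalIdeal 𝔯⁰ K)`; «`S` non-maximal» is
`∃ a : 𝓞 K, (a : K) ∉ 𝔯`, cf. `EndOrder.conductorIdeal_eq_top_iff`).  The GLOBAL type `type(𝔯) = max_𝔭 type_𝔭(𝔯)`
of DEFINITION 3.2 (ii) is written as the supremum `⨆ 𝔭 : MaximalSpectrum 𝔯, type_𝔭(𝔯)` in `ℕ` (the primes of an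
order are its maximal ideals, `CMLatticeOrderDedekindIffMaximal.isMaximal_of_isPrime_endOrder`); it is bounded
(§2) hence a maximum.  THEOREMS ONLY: no definition, no instance, no named fact (net Literature debt `0`).

## Source, VERBATIM

S. Marseglia, *Cohen-Macaulay type of orders, generators and ideal classes*, J. Algebra 658 (2024) 247–276
[Marseglia2024CMType] (arXiv:2206.03758, held `paper:arxiv-2206.03758`), §3, chunk p0009:

> "Definition 3.2. Let `𝔭` be a prime of `S`. We say that: (i) the (Cohen-Macaulay) type of `S` at `𝔭` is
> `type_𝔭(S) := dim_{S/𝔭} Sᵗ/𝔭Sᵗ`. (ii) the (Cohen-Macaulay) type of `S` is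
> `type(S) := max{type_𝔭(S) : 𝔭 is a prime of S}`.  Note that `type(S)` is a finite quantity since `type_𝔭(S) = 1`
> for almost all primes `𝔭` of `S`, as we show in the next Proposition.
> Proposition 3.3. Let `𝔭` be an invertible prime of `S`. Then `type_𝔭(S) = 1`. In particular `type(S)` is a finite
> positive integer. […]
> Proposition 3.5. Let `𝔭` be a non-invertible prime of `S`. Then `type_𝔭(S) + 1 = dim_{S/𝔭} (𝔭:𝔭)/𝔭`. […]
> Corollary 3.6. Let `S` be a non-maximal order. Then `type(S) + 1 = max{dim_{S/𝔭} (𝔭:𝔭)/𝔭 : 𝔭 is a prime of S}`.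
> Proof. If `𝔭` is invertible then `type_𝔭(S) = 1` by Proposition 3.3. Hence in the definition of the global type
> for a non-maximal order it is enough to consider the non invertible primes. Also, by Lemma 2.14, if `𝔭` is
> invertible then `S/𝔭 = (𝔭:𝔭)/𝔭`. Hence also in the right hand side of the equality in the statement, we can
> restrict ourselves to the non-invertible primes of `S`. Therefore the conclusion follows from Proposition 3.5."

and §1, chunk p0003: "Main Theorem 1. Let `S` be an order in `K`. Then […] (2) If `S ≠ 𝒪_K` then
`type(S) + 1 = max{dim_{S/𝔭} (𝔭:𝔭)/𝔭 : 𝔭 is a prime of S}`. (3) Assume that `dim_Q(K) > 1`. Then the type of an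
order in `K` is bounded by `dim_Q(K) − 1`. Moreover, this bound is attained: if `p` is a prime of `Z` then the order
`T = Z + p𝒪_K` satisfies `type(T) = dim_Q(K) − 1`."  Also §3 Prop. 3.4 (p0009): "`S` is Gorenstein ⟺ `type_𝔭(S) = 1`
for every prime `𝔭`" (so `type(S) = 1` iff `S` is Gorenstein).

## What is formalised (the printed proof, step by step)

* §1 prime by prime: «if `𝔭` is invertible then `S/𝔭 = (𝔭:𝔭)/𝔭`» (`finrank_div_self_quotient_eq_one_of_isUnit_coeIdeal`);
  `dim (𝔭:𝔭)/𝔭 ≤ type_𝔭 + 1` at every prime (`finrank_div_self_quotient_le_finrank_traceDual_quotient_add_one`) with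
  equality iff `𝔭` is NOT invertible (`finrank_div_self_quotient_eq_finrank_traceDual_quotient_add_one_iff`; `⟸` is
  PROP. 3.5 of `CMOrderCohenMacaulayTypeBound`, `⟹` is PROP. 3.3).
* §2 DEFINITION 3.2 (ii) / PROPOSITION 3.3 «`type(S)` is a finite positive integer»: the family `𝔭 ↦ type_𝔭(𝔯)` is
  bounded (`bddAbove_range_finrank_traceDual_quotient`, by `[K:ℚ]`), the maximum is attained
  (`exists_finrank_traceDual_quotient_eq_iSup`), `1 ≤ type(𝔯)` (`one_le_iSup_finrank_traceDual_quotient`); PROP. 3.4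
  in global form «`type(𝔯) = 1 ⟺ type_𝔭(𝔯) = 1` at every prime» (`iSup_finrank_traceDual_quotient_eq_one_iff`); «`S` is
  non-maximal iff it has a non-invertible prime» (`exists_not_isUnit_coeIdeal_iff`).
* §3 **COROLLARY 3.6 = MAIN THEOREM 1 (2), `iSup_finrank_traceDual_quotient_add_one_eq`:
  `(⨆_𝔭 type_𝔭(𝔯)) + 1 = ⨆_𝔭 dim_{𝔯/𝔭} (𝔭:𝔭)/𝔭(𝔭:𝔭)` when `𝔯 ≠ 𝒪_K`**; and the hypothesis is needed: for `𝔯 = 𝒪_K`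
  both suprema equal `1` (`iSup_finrank_traceDual_quotient_eq_one_of_forall_mem`,
  `iSup_finrank_div_self_quotient_eq_one_of_forall_mem`).
* §4 MAIN THEOREM 1 (3) in global form: `type(𝔯) ≤ [K:ℚ] − 1` when `[K:ℚ] ≥ 2`
  (`iSup_finrank_traceDual_quotient_le_card_sub_one`) and `type(ℤ + p𝒪_K) = [K:ℚ] − 1`
  (`iSup_finrank_traceDual_quotient_eq_card_sub_one`, from `CMOrderCohenMacaulayTypeAttained`).
-/

noncomputable section

open scoped nonZeroDivisors NumberField
open NumberField Module FractionalIdeal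
open Submodule (traceDual)

namespace Literature.NumberTheory.ComplexMultiplication

namespace CMTypeLattice

variable {K : Type} [Field K] [NumberField K]
variable {ι : Type} [Fintype ι] [DecidableEq ι] (μ : Basis ι ℚ K) [Nonempty ι]
variable [IsFractionRing (endOrder (Algebra.leftMulMatrix μ)) K]

/-! ## §1 Prime by prime: `dim_{𝔯/𝔭} (𝔭:𝔭)/𝔭` versus `type_𝔭(𝔯) + 1` -/

/-- **«If `𝔭` is invertible then `S/𝔭 = (𝔭:𝔭)/𝔭`»: `dim_{𝔯/𝔭} (𝔭:𝔭)/𝔭(𝔭:𝔭) = 1` at an invertible prime** (every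
`I_𝔭` is principal at an invertible prime, LEMMA 2.13). [cite: Marseglia2024CMType, §3 Cor. 3.6 (proof: «if `𝔭` is
invertible then `S/𝔭 = (𝔭:𝔭)/𝔭`»), p. 9; §2.5 Lemma 2.13, p. 7] -/
theorem finrank_div_self_quotient_eq_one_of_isUnit_coeIdeal {𝔭 : Ideal (endOrder (Algebra.leftMulMatrix μ))}
    [𝔭.IsPrime] (h0 : 𝔭 ≠ ⊥) (hu : IsUnit (𝔭 : FractionalIdeal (endOrder (Algebra.leftMulMatrix μ))⁰ K)) :
    Module.finrank (endOrder (Algebra.leftMulMatrix μ) ⧸ 𝔭)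
      ((((𝔭 : FractionalIdeal (endOrder (Algebra.leftMulMatrix μ))⁰ K) / 𝔭 :
        FractionalIdeal (endOrder (Algebra.leftMulMatrix μ))⁰ K) : Submodule (endOrder (Algebra.leftMulMatrix μ)) K) ⧸
        (𝔭 • ⊤ : Submodule (endOrder (Algebra.leftMulMatrix μ))
          (((𝔭 : FractionalIdeal (endOrder (Algebra.leftMulMatrix μ))⁰ K) / 𝔭 :
            FractionalIdeal (endOrder (Algebra.leftMulMatrix μ))⁰ K) : Submodule (endOrder (Algebra.leftMulMatrix μ)) K))) =
      1 :=
  EndOrder.finrank_quotient_eq_one_of_isUnit_coeIdeal h0 hu (EndOrder.div_self_ne_zero (coeIdeal_ne_zero.2 h0))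

/-- **`dim_{𝔯/𝔭} (𝔭:𝔭)/𝔭 ≤ type_𝔭(𝔯) + 1` at every prime `𝔭 ≠ 0`** (`= type_𝔭 + 1` at a non-invertible prime,
PROP. 3.5; `= 1 < 2 = type_𝔭 + 1` at an invertible one, PROP. 3.3 and LEMMA 2.13). [cite: Marseglia2024CMType, §3
Prop. 3.3, Prop. 3.5, Cor. 3.6 (proof), p. 9] -/
theorem finrank_div_self_quotient_le_finrank_traceDual_quotient_add_one
    {T : FractionalIdeal (endOrder (Algebra.leftMulMatrix μ))⁰ K}
    (hT : (T : Submodule (endOrder (Algebra.leftMulMatrix μ)) K) =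
      traceDual ℤ ℚ ((1 : FractionalIdeal (endOrder (Algebra.leftMulMatrix μ))⁰ K) :
        Submodule (endOrder (Algebra.leftMulMatrix μ)) K))
    {𝔭 : Ideal (endOrder (Algebra.leftMulMatrix μ))} [h𝔭 : 𝔭.IsPrime] (h0 : 𝔭 ≠ ⊥) :
    Module.finrank (endOrder (Algebra.leftMulMatrix μ) ⧸ 𝔭)
      ((((𝔭 : FractionalIdeal (endOrder (Algebra.leftMulMatrix μ))⁰ K) / 𝔭 :
        FractionalIdeal (endOrder (Algebra.leftMulMatrix μ))⁰ K) : Submodule (endOrder (Algebra.leftMulMatrix μ)) K) ⧸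
        (𝔭 • ⊤ : Submodule (endOrder (Algebra.leftMulMatrix μ))
          (((𝔭 : FractionalIdeal (endOrder (Algebra.leftMulMatrix μ))⁰ K) / 𝔭 :
            FractionalIdeal (endOrder (Algebra.leftMulMatrix μ))⁰ K) : Submodule (endOrder (Algebra.leftMulMatrix μ)) K))) ≤
      Module.finrank (endOrder (Algebra.leftMulMatrix μ) ⧸ 𝔭)
        ((T : Submodule (endOrder (Algebra.leftMulMatrix μ)) K) ⧸
          (𝔭 • ⊤ : Submodule (endOrder (Algebra.leftMulMatrix μ))
            (T : Submodule (endOrder (Algebra.leftMulMatrix μ)) K))) + 1 := by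
  haveI := isMaximal_of_isPrime_endOrder (Algebra.leftMulMatrix μ) h𝔭 h0
  by_cases hu : IsUnit (𝔭 : FractionalIdeal (endOrder (Algebra.leftMulMatrix μ))⁰ K)
  · rw [finrank_div_self_quotient_eq_one_of_isUnit_coeIdeal μ h0 hu]
    exact Nat.le_add_left 1 _
  · exact (finrank_traceDual_quotient_add_one_eq μ hT 𝔭 hu).ge

/-- **`dim_{𝔯/𝔭} (𝔭:𝔭)/𝔭 = type_𝔭(𝔯) + 1` holds EXACTLY at the non-invertible primes** (PROP. 3.5; at an invertible
prime both `type_𝔭` and `dim (𝔭:𝔭)/𝔭` are `1`). [cite: Marseglia2024CMType, §3 Prop. 3.3, Prop. 3.5, Cor. 3.6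
(proof: «we can restrict ourselves to the non-invertible primes of `S`»), p. 9] -/
theorem finrank_div_self_quotient_eq_finrank_traceDual_quotient_add_one_iff
    {T : FractionalIdeal (endOrder (Algebra.leftMulMatrix μ))⁰ K}
    (hT : (T : Submodule (endOrder (Algebra.leftMulMatrix μ)) K) =
      traceDual ℤ ℚ ((1 : FractionalIdeal (endOrder (Algebra.leftMulMatrix μ))⁰ K) :
        Submodule (endOrder (Algebra.leftMulMatrix μ)) K))
    {𝔭 : Ideal (endOrder (Algebra.leftMulMatrix μ))} [h𝔭 : 𝔭.IsPrime] (h0 : 𝔭 ≠ ⊥) :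
    Module.finrank (endOrder (Algebra.leftMulMatrix μ) ⧸ 𝔭)
      ((((𝔭 : FractionalIdeal (endOrder (Algebra.leftMulMatrix μ))⁰ K) / 𝔭 :
        FractionalIdeal (endOrder (Algebra.leftMulMatrix μ))⁰ K) : Submodule (endOrder (Algebra.leftMulMatrix μ)) K) ⧸
        (𝔭 • ⊤ : Submodule (endOrder (Algebra.leftMulMatrix μ))
          (((𝔭 : FractionalIdeal (endOrder (Algebra.leftMulMatrix μ))⁰ K) / 𝔭 :
            FractionalIdeal (endOrder (Algebra.leftMulMatrix μ))⁰ K) : Submodule (endOrder (Algebra.leftMulMatrix μ)) K))) =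
      Module.finrank (endOrder (Algebra.leftMulMatrix μ) ⧸ 𝔭)
        ((T : Submodule (endOrder (Algebra.leftMulMatrix μ)) K) ⧸
          (𝔭 • ⊤ : Submodule (endOrder (Algebra.leftMulMatrix μ))
            (T : Submodule (endOrder (Algebra.leftMulMatrix μ)) K))) + 1 ↔
      ¬ IsUnit (𝔭 : FractionalIdeal (endOrder (Algebra.leftMulMatrix μ))⁰ K) := by
  haveI := isMaximal_of_isPrime_endOrder (Algebra.leftMulMatrix μ) h𝔭 h0
  refine ⟨fun h hu ↦ ?_, fun hu ↦ (finrank_traceDual_quotient_add_one_eq μ hT 𝔭 hu).symm⟩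
  rw [finrank_div_self_quotient_eq_one_of_isUnit_coeIdeal μ h0 hu,
    finrank_traceDual_quotient_eq_one_of_isUnit_coeIdeal μ hT h0 hu] at h
  omega

/-! ## §2 DEFINITION 3.2 (ii): the global type `type(𝔯) = max_𝔭 type_𝔭(𝔯) = ⨆ 𝔭, type_𝔭(𝔯)` is a finite positive
integer (PROPOSITION 3.3) -/

omit [Nonempty ι] [IsFractionRing (endOrder (Algebra.leftMulMatrix μ)) K] in
/-- The order `𝔯` has a maximal ideal (it is not a field), so `max_𝔭` ranges over a nonempty set.
[cite: Marseglia2024CMType, §2.4 Lemma 2.7, p. 6] -/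
theorem nonempty_maximalSpectrum : Nonempty (MaximalSpectrum (endOrder (Algebra.leftMulMatrix μ))) := by
  obtain ⟨𝔪, h𝔪⟩ := Ideal.exists_maximal (endOrder (Algebra.leftMulMatrix μ))
  exact ⟨⟨𝔪, h𝔪⟩⟩

omit [IsFractionRing (endOrder (Algebra.leftMulMatrix μ)) K] in
/-- A maximal ideal of the order `𝔯` is a nonzero prime. [cite: Marseglia2024CMType, §2.4 Lemma 2.7 («every
non-zero prime ideal is maximal»), p. 6] -/
theorem asIdeal_ne_bot (𝔭 : MaximalSpectrum (endOrder (Algebra.leftMulMatrix μ))) : 𝔭.asIdeal ≠ ⊥ :=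
  Ring.ne_bot_of_isMaximal_of_not_isField 𝔭.isMaximal EndOrder.not_isField

/-- **«`type(S)` is a finite quantity»: the local types `type_𝔭(𝔯)` are bounded** (uniformly by `[K:ℚ]`,
`CMOrderIdealGeneratorsCount.finrank_quotient_smul_top_le_card`). [cite: Marseglia2024CMType, §3 Def. 3.2 («Note that
`type(S)` is a finite quantity»), Prop. 3.3, p. 9] -/
theorem bddAbove_range_finrank_traceDual_quotient {T : FractionalIdeal (endOrder (Algebra.leftMulMatrix μ))⁰ K}
    (hT : (T : Submodule (endOrder (Algebra.leftMulMatrix μ)) K) =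
      traceDual ℤ ℚ ((1 : FractionalIdeal (endOrder (Algebra.leftMulMatrix μ))⁰ K) :
        Submodule (endOrder (Algebra.leftMulMatrix μ)) K)) :
    BddAbove (Set.range fun 𝔭 : MaximalSpectrum (endOrder (Algebra.leftMulMatrix μ)) ↦
      Module.finrank (endOrder (Algebra.leftMulMatrix μ) ⧸ 𝔭.asIdeal)
        ((T : Submodule (endOrder (Algebra.leftMulMatrix μ)) K) ⧸
          (𝔭.asIdeal • ⊤ : Submodule (endOrder (Algebra.leftMulMatrix μ))
            (T : Submodule (endOrder (Algebra.leftMulMatrix μ)) K)))) := by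
  refine ⟨Fintype.card ι, ?_⟩
  rintro _ ⟨𝔭, rfl⟩
  exact finrank_quotient_smul_top_le_card μ (ne_zero_of_coe_eq_traceDual_one μ hT) (asIdeal_ne_bot μ 𝔭)

/-- The dimensions `dim_{𝔯/𝔭} (𝔭:𝔭)/𝔭` are bounded too (by `[K:ℚ]`), so their `max_𝔭` is a maximum.
[cite: Marseglia2024CMType, §3 Cor. 3.6, p. 9; §4 Lemma 4.2, p. 10] -/
theorem bddAbove_range_finrank_div_self_quotient :
    BddAbove (Set.range fun 𝔭 : MaximalSpectrum (endOrder (Algebra.leftMulMatrix μ)) ↦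
      Module.finrank (endOrder (Algebra.leftMulMatrix μ) ⧸ 𝔭.asIdeal)
        ((((𝔭.asIdeal : FractionalIdeal (endOrder (Algebra.leftMulMatrix μ))⁰ K) / 𝔭.asIdeal :
          FractionalIdeal (endOrder (Algebra.leftMulMatrix μ))⁰ K) : Submodule (endOrder (Algebra.leftMulMatrix μ)) K) ⧸
          (𝔭.asIdeal • ⊤ : Submodule (endOrder (Algebra.leftMulMatrix μ))
            (((𝔭.asIdeal : FractionalIdeal (endOrder (Algebra.leftMulMatrix μ))⁰ K) / 𝔭.asIdeal :
              FractionalIdeal (endOrder (Algebra.leftMulMatrix μ))⁰ K) :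
                Submodule (endOrder (Algebra.leftMulMatrix μ)) K)))) := by
  refine ⟨Fintype.card ι, ?_⟩
  rintro _ ⟨𝔭, rfl⟩
  exact finrank_quotient_smul_top_le_card μ (EndOrder.div_self_ne_zero (coeIdeal_ne_zero.2 (asIdeal_ne_bot μ 𝔭)))
    (asIdeal_ne_bot μ 𝔭)

/-- **«There exists a prime `𝔭` of `S` such that `type_𝔭(S) = type(S)`»: the global type is attained.**
[cite: Marseglia2024CMType, §3 Def. 3.2 (ii) («`type(S) := max{type_𝔭(S)}`»), p. 9; §4 Prop. 4.9 (proof: «there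
exists a prime `𝔭` of `S` such that `type_𝔭(S) = type(S)`»), p. 11] -/
theorem exists_finrank_traceDual_quotient_eq_iSup {T : FractionalIdeal (endOrder (Algebra.leftMulMatrix μ))⁰ K}
    (hT : (T : Submodule (endOrder (Algebra.leftMulMatrix μ)) K) =
      traceDual ℤ ℚ ((1 : FractionalIdeal (endOrder (Algebra.leftMulMatrix μ))⁰ K) :
        Submodule (endOrder (Algebra.leftMulMatrix μ)) K)) :
    ∃ 𝔭 : MaximalSpectrum (endOrder (Algebra.leftMulMatrix μ)),
      Module.finrank (endOrder (Algebra.leftMulMatrix μ) ⧸ 𝔭.asIdeal)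
        ((T : Submodule (endOrder (Algebra.leftMulMatrix μ)) K) ⧸
          (𝔭.asIdeal • ⊤ : Submodule (endOrder (Algebra.leftMulMatrix μ))
            (T : Submodule (endOrder (Algebra.leftMulMatrix μ)) K))) =
      ⨆ 𝔭 : MaximalSpectrum (endOrder (Algebra.leftMulMatrix μ)),
        Module.finrank (endOrder (Algebra.leftMulMatrix μ) ⧸ 𝔭.asIdeal)
          ((T : Submodule (endOrder (Algebra.leftMulMatrix μ)) K) ⧸
            (𝔭.asIdeal • ⊤ : Submodule (endOrder (Algebra.leftMulMatrix μ))
              (T : Submodule (endOrder (Algebra.leftMulMatrix μ)) K))) := by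
  haveI := nonempty_maximalSpectrum μ
  obtain ⟨𝔭, h𝔭⟩ := Nat.sSup_mem (Set.range_nonempty _) (bddAbove_range_finrank_traceDual_quotient μ hT)
  exact ⟨𝔭, h𝔭⟩

/-- **PROPOSITION 3.3, global half: «`type(S)` is a finite positive integer», `1 ≤ type(𝔯)`.**
[cite: Marseglia2024CMType, §3 Prop. 3.3, p. 9] -/
theorem one_le_iSup_finrank_traceDual_quotient {T : FractionalIdeal (endOrder (Algebra.leftMulMatrix μ))⁰ K}
    (hT : (T : Submodule (endOrder (Algebra.leftMulMatrix μ)) K) =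
      traceDual ℤ ℚ ((1 : FractionalIdeal (endOrder (Algebra.leftMulMatrix μ))⁰ K) :
        Submodule (endOrder (Algebra.leftMulMatrix μ)) K)) :
    1 ≤ ⨆ 𝔭 : MaximalSpectrum (endOrder (Algebra.leftMulMatrix μ)),
        Module.finrank (endOrder (Algebra.leftMulMatrix μ) ⧸ 𝔭.asIdeal)
          ((T : Submodule (endOrder (Algebra.leftMulMatrix μ)) K) ⧸
            (𝔭.asIdeal • ⊤ : Submodule (endOrder (Algebra.leftMulMatrix μ))
              (T : Submodule (endOrder (Algebra.leftMulMatrix μ)) K))) := by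
  obtain ⟨𝔭₀⟩ := nonempty_maximalSpectrum μ
  exact le_ciSup_of_le (bddAbove_range_finrank_traceDual_quotient μ hT) 𝔭₀
    (Nat.one_le_iff_ne_zero.2 (finrank_traceDual_quotient_pos μ hT (asIdeal_ne_bot μ 𝔭₀)).ne')

/-- **PROPOSITION 3.4 in global form: `type(𝔯) = 1 ⟺ type_𝔭(𝔯) = 1` at every prime** (`⟺ 𝔯` is Gorenstein,
`CMOrderCohenMacaulayTypeOne.forall_finrank_traceDual_quotient_eq_one_iff_isUnit`). [cite: Marseglia2024CMType, §3
Prop. 3.4 ((1)⟺(2)), p. 9; §4 Prop. 4.9 (proof: «If `S` is Gorenstein then `type(S) = 1` by Proposition 3.4»), p. 11] -/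
theorem iSup_finrank_traceDual_quotient_eq_one_iff {T : FractionalIdeal (endOrder (Algebra.leftMulMatrix μ))⁰ K}
    (hT : (T : Submodule (endOrder (Algebra.leftMulMatrix μ)) K) =
      traceDual ℤ ℚ ((1 : FractionalIdeal (endOrder (Algebra.leftMulMatrix μ))⁰ K) :
        Submodule (endOrder (Algebra.leftMulMatrix μ)) K)) :
    ⨆ 𝔭 : MaximalSpectrum (endOrder (Algebra.leftMulMatrix μ)),
        Module.finrank (endOrder (Algebra.leftMulMatrix μ) ⧸ 𝔭.asIdeal)
          ((T : Submodule (endOrder (Algebra.leftMulMatrix μ)) K) ⧸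
            (𝔭.asIdeal • ⊤ : Submodule (endOrder (Algebra.leftMulMatrix μ))
              (T : Submodule (endOrder (Algebra.leftMulMatrix μ)) K))) = 1 ↔
      ∀ 𝔭 : MaximalSpectrum (endOrder (Algebra.leftMulMatrix μ)),
        Module.finrank (endOrder (Algebra.leftMulMatrix μ) ⧸ 𝔭.asIdeal)
          ((T : Submodule (endOrder (Algebra.leftMulMatrix μ)) K) ⧸
            (𝔭.asIdeal • ⊤ : Submodule (endOrder (Algebra.leftMulMatrix μ))
              (T : Submodule (endOrder (Algebra.leftMulMatrix μ)) K))) = 1 := by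
  have hbdd := bddAbove_range_finrank_traceDual_quotient μ hT
  have h1 := one_le_iSup_finrank_traceDual_quotient μ hT
  refine ⟨fun h 𝔭 ↦ le_antisymm ((le_ciSup hbdd 𝔭).trans h.le)
      (Nat.one_le_iff_ne_zero.2 (finrank_traceDual_quotient_pos μ hT (asIdeal_ne_bot μ 𝔭)).ne'),
    fun h ↦ le_antisymm (ciSup_le' fun 𝔭 ↦ (h 𝔭).le) h1⟩

/-- **«`S` is a non-maximal order» ⟺ `S` has a non-invertible prime** (`S ≠ 𝒪_K ⟺ 𝔣_S ≠ S ⟺` some maximal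
`𝔭 ⊇ 𝔣_S`, and `𝔭` is invertible iff `𝔭 ⊉ 𝔣_S`). [cite: Marseglia2024CMType, §3 Cor. 3.6 («Let `S` be a non-maximal
order»; proof: «it is enough to consider the non invertible primes»), p. 9; §2.5 Lemma 2.14 (i), p. 7] -/
theorem exists_not_isUnit_coeIdeal_iff :
    (∃ 𝔭 : MaximalSpectrum (endOrder (Algebra.leftMulMatrix μ)),
      ¬ IsUnit (𝔭.asIdeal : FractionalIdeal (endOrder (Algebra.leftMulMatrix μ))⁰ K)) ↔
      ∃ a : 𝓞 K, (a : K) ∉ endOrder (Algebra.leftMulMatrix μ) := by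
  constructor
  · rintro ⟨𝔭, h𝔭⟩
    by_contra hall
    push Not at hall
    have htop := (EndOrder.conductorIdeal_eq_top_iff (ρ := Algebra.leftMulMatrix μ)).2 hall
    exact h𝔭 ((EndOrder.isUnit_coeIdeal_iff_not_conductorIdeal_le 𝔭.isMaximal.isPrime (asIdeal_ne_bot μ 𝔭)).2
      (fun hle ↦ 𝔭.isMaximal.ne_top (top_le_iff.1 (htop.symm.trans_le hle))))
  · rintro ⟨a, ha⟩
    have htop : EndOrder.conductorIdeal (Algebra.leftMulMatrix μ) ≠ ⊤ := fun h ↦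
      ha ((EndOrder.conductorIdeal_eq_top_iff (ρ := Algebra.leftMulMatrix μ)).1 h a)
    obtain ⟨𝔪, h𝔪, hle⟩ := Ideal.exists_le_maximal _ htop
    exact ⟨⟨𝔪, h𝔪⟩, fun hu ↦ (EndOrder.isUnit_coeIdeal_iff_not_conductorIdeal_le h𝔪.isPrime
      (asIdeal_ne_bot μ ⟨𝔪, h𝔪⟩)).1 hu hle⟩

/-! ## §3 COROLLARY 3.6 = MAIN THEOREM 1 (2): `type(S) + 1 = max_𝔭 dim_{S/𝔭} (𝔭:𝔭)/𝔭` for non-maximal `S` -/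

/-- **MARSEGLIA 2024 COROLLARY 3.6 = MAIN THEOREM 1 (2): for a NON-MAXIMAL order `𝔯 ≠ 𝒪_K`,
`type(𝔯) + 1 = max_𝔭 dim_{𝔯/𝔭} (𝔭:𝔭)/𝔭`**, with `type(𝔯) = ⨆_𝔭 type_𝔭(𝔯)` over the primes (= maximal ideals) of
`𝔯 = endOrder (M_μ)` and `(𝔭:𝔭)/𝔭 = (𝔭:𝔭)/𝔭(𝔭:𝔭)` as `↥↑(↑𝔭/↑𝔭) ⧸ 𝔭 • ⊤`.  Printed proof: at an invertible prime
`type_𝔭 = 1` (PROP. 3.3) and `dim (𝔭:𝔭)/𝔭 = 1`, so both maxima are computed on the non-invertible primes (there is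
one since `𝔯 ≠ 𝒪_K`), where `type_𝔭 + 1 = dim (𝔭:𝔭)/𝔭` (PROP. 3.5). [cite: Marseglia2024CMType, §3 Cor. 3.6, p. 9;
§1 Main Theorem 1 (2), p. 3] -/
theorem iSup_finrank_traceDual_quotient_add_one_eq {T : FractionalIdeal (endOrder (Algebra.leftMulMatrix μ))⁰ K}
    (hT : (T : Submodule (endOrder (Algebra.leftMulMatrix μ)) K) =
      traceDual ℤ ℚ ((1 : FractionalIdeal (endOrder (Algebra.leftMulMatrix μ))⁰ K) :
        Submodule (endOrder (Algebra.leftMulMatrix μ)) K))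
    (hS : ∃ a : 𝓞 K, (a : K) ∉ endOrder (Algebra.leftMulMatrix μ)) :
    (⨆ 𝔭 : MaximalSpectrum (endOrder (Algebra.leftMulMatrix μ)),
        Module.finrank (endOrder (Algebra.leftMulMatrix μ) ⧸ 𝔭.asIdeal)
          ((T : Submodule (endOrder (Algebra.leftMulMatrix μ)) K) ⧸
            (𝔭.asIdeal • ⊤ : Submodule (endOrder (Algebra.leftMulMatrix μ))
              (T : Submodule (endOrder (Algebra.leftMulMatrix μ)) K)))) + 1 =
      ⨆ 𝔭 : MaximalSpectrum (endOrder (Algebra.leftMulMatrix μ)),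
        Module.finrank (endOrder (Algebra.leftMulMatrix μ) ⧸ 𝔭.asIdeal)
          ((((𝔭.asIdeal : FractionalIdeal (endOrder (Algebra.leftMulMatrix μ))⁰ K) / 𝔭.asIdeal :
            FractionalIdeal (endOrder (Algebra.leftMulMatrix μ))⁰ K) : Submodule (endOrder (Algebra.leftMulMatrix μ)) K) ⧸
            (𝔭.asIdeal • ⊤ : Submodule (endOrder (Algebra.leftMulMatrix μ))
              (((𝔭.asIdeal : FractionalIdeal (endOrder (Algebra.leftMulMatrix μ))⁰ K) / 𝔭.asIdeal :
                FractionalIdeal (endOrder (Algebra.leftMulMatrix μ))⁰ K) :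
                  Submodule (endOrder (Algebra.leftMulMatrix μ)) K))) := by
  obtain ⟨𝔭₀, h𝔭₀⟩ := (exists_not_isUnit_coeIdeal_iff μ).2 hS
  haveI : Nonempty (MaximalSpectrum (endOrder (Algebra.leftMulMatrix μ))) := ⟨𝔭₀⟩
  have hbT := bddAbove_range_finrank_traceDual_quotient μ hT
  have hbD := bddAbove_range_finrank_div_self_quotient μ
  -- the non-invertible prime `𝔭₀` gives `max_𝔭 dim (𝔭:𝔭)/𝔭 ≥ type_{𝔭₀} + 1 ≥ 2`
  have h0 := (finrank_div_self_quotient_eq_finrank_traceDual_quotient_add_one_iff μ hT (asIdeal_ne_bot μ 𝔭₀)).2 h𝔭₀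
  have h2 := le_ciSup hbD 𝔭₀
  rw [h0] at h2
  have hpos := finrank_traceDual_quotient_pos μ hT (asIdeal_ne_bot μ 𝔭₀)
  refine le_antisymm ?_ (ciSup_le fun 𝔭 ↦
    (finrank_div_self_quotient_le_finrank_traceDual_quotient_add_one μ hT (asIdeal_ne_bot μ 𝔭)).trans
      (Nat.succ_le_succ (le_ciSup hbT 𝔭)))
  -- `type_𝔭 + 1 ≤ max dim` at every prime: at a non-invertible one by PROP. 3.5, at an invertible one `type_𝔭 + 1 = 2`
  suffices h : ∀ 𝔭 : MaximalSpectrum (endOrder (Algebra.leftMulMatrix μ)),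
      Module.finrank (endOrder (Algebra.leftMulMatrix μ) ⧸ 𝔭.asIdeal)
          ((T : Submodule (endOrder (Algebra.leftMulMatrix μ)) K) ⧸
            (𝔭.asIdeal • ⊤ : Submodule (endOrder (Algebra.leftMulMatrix μ))
              (T : Submodule (endOrder (Algebra.leftMulMatrix μ)) K))) + 1 ≤
      ⨆ 𝔭 : MaximalSpectrum (endOrder (Algebra.leftMulMatrix μ)),
        Module.finrank (endOrder (Algebra.leftMulMatrix μ) ⧸ 𝔭.asIdeal)
          ((((𝔭.asIdeal : FractionalIdeal (endOrder (Algebra.leftMulMatrix μ))⁰ K) / 𝔭.asIdeal :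
            FractionalIdeal (endOrder (Algebra.leftMulMatrix μ))⁰ K) : Submodule (endOrder (Algebra.leftMulMatrix μ)) K) ⧸
            (𝔭.asIdeal • ⊤ : Submodule (endOrder (Algebra.leftMulMatrix μ))
              (((𝔭.asIdeal : FractionalIdeal (endOrder (Algebra.leftMulMatrix μ))⁰ K) / 𝔭.asIdeal :
                FractionalIdeal (endOrder (Algebra.leftMulMatrix μ))⁰ K) :
                  Submodule (endOrder (Algebra.leftMulMatrix μ)) K))) by
    have h' := ciSup_le fun 𝔭 ↦ Nat.le_sub_one_of_lt (h 𝔭)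
    omega
  intro 𝔭
  by_cases hu : IsUnit (𝔭.asIdeal : FractionalIdeal (endOrder (Algebra.leftMulMatrix μ))⁰ K)
  · rw [finrank_traceDual_quotient_eq_one_of_isUnit_coeIdeal μ hT (asIdeal_ne_bot μ 𝔭) hu]
    omega
  · rw [← (finrank_div_self_quotient_eq_finrank_traceDual_quotient_add_one_iff μ hT (asIdeal_ne_bot μ 𝔭)).2 hu]
    exact le_ciSup hbD 𝔭

/-- **The hypothesis «non-maximal» is needed: for the maximal order `𝔯 = 𝒪_K` every prime is invertible and
`type(𝒪_K) = 1`** (so `type + 1 = 2 ≠ 1 = max_𝔭 dim (𝔭:𝔭)/𝔭`, next statement). [cite: Marseglia2024CMType, §3 Cor. 3.6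
(«Let `S` be a non-maximal order»), Prop. 3.3, p. 9] -/
theorem iSup_finrank_traceDual_quotient_eq_one_of_forall_mem
    {T : FractionalIdeal (endOrder (Algebra.leftMulMatrix μ))⁰ K}
    (hT : (T : Submodule (endOrder (Algebra.leftMulMatrix μ)) K) =
      traceDual ℤ ℚ ((1 : FractionalIdeal (endOrder (Algebra.leftMulMatrix μ))⁰ K) :
        Submodule (endOrder (Algebra.leftMulMatrix μ)) K))
    (hS : ∀ a : 𝓞 K, (a : K) ∈ endOrder (Algebra.leftMulMatrix μ)) :
    ⨆ 𝔭 : MaximalSpectrum (endOrder (Algebra.leftMulMatrix μ)),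
        Module.finrank (endOrder (Algebra.leftMulMatrix μ) ⧸ 𝔭.asIdeal)
          ((T : Submodule (endOrder (Algebra.leftMulMatrix μ)) K) ⧸
            (𝔭.asIdeal • ⊤ : Submodule (endOrder (Algebra.leftMulMatrix μ))
              (T : Submodule (endOrder (Algebra.leftMulMatrix μ)) K))) = 1 := by
  refine (iSup_finrank_traceDual_quotient_eq_one_iff μ hT).2 fun 𝔭 ↦
    finrank_traceDual_quotient_eq_one_of_isUnit_coeIdeal μ hT (asIdeal_ne_bot μ 𝔭) ?_
  by_contra hu
  obtain ⟨a, ha⟩ := (exists_not_isUnit_coeIdeal_iff μ).1 ⟨𝔭, hu⟩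
  exact ha (hS a)

/-- **… and `max_𝔭 dim_{𝒪_K/𝔭} (𝔭:𝔭)/𝔭 = 1` for the maximal order** (every prime invertible), so COROLLARY 3.6 fails
for `S = 𝒪_K`. [cite: Marseglia2024CMType, §3 Cor. 3.6 («Let `S` be a non-maximal order»; proof: «if `𝔭` is
invertible then `S/𝔭 = (𝔭:𝔭)/𝔭`»), p. 9] -/
theorem iSup_finrank_div_self_quotient_eq_one_of_forall_mem
    (hS : ∀ a : 𝓞 K, (a : K) ∈ endOrder (Algebra.leftMulMatrix μ)) :
    ⨆ 𝔭 : MaximalSpectrum (endOrder (Algebra.leftMulMatrix μ)),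
        Module.finrank (endOrder (Algebra.leftMulMatrix μ) ⧸ 𝔭.asIdeal)
          ((((𝔭.asIdeal : FractionalIdeal (endOrder (Algebra.leftMulMatrix μ))⁰ K) / 𝔭.asIdeal :
            FractionalIdeal (endOrder (Algebra.leftMulMatrix μ))⁰ K) : Submodule (endOrder (Algebra.leftMulMatrix μ)) K) ⧸
            (𝔭.asIdeal • ⊤ : Submodule (endOrder (Algebra.leftMulMatrix μ))
              (((𝔭.asIdeal : FractionalIdeal (endOrder (Algebra.leftMulMatrix μ))⁰ K) / 𝔭.asIdeal :
                FractionalIdeal (endOrder (Algebra.leftMulMatrix μ))⁰ K) :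
                  Submodule (endOrder (Algebra.leftMulMatrix μ)) K))) = 1 := by
  haveI := nonempty_maximalSpectrum μ
  have h : ∀ 𝔭 : MaximalSpectrum (endOrder (Algebra.leftMulMatrix μ)),
      Module.finrank (endOrder (Algebra.leftMulMatrix μ) ⧸ 𝔭.asIdeal)
        ((((𝔭.asIdeal : FractionalIdeal (endOrder (Algebra.leftMulMatrix μ))⁰ K) / 𝔭.asIdeal :
          FractionalIdeal (endOrder (Algebra.leftMulMatrix μ))⁰ K) : Submodule (endOrder (Algebra.leftMulMatrix μ)) K) ⧸
          (𝔭.asIdeal • ⊤ : Submodule (endOrder (Algebra.leftMulMatrix μ))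
            (((𝔭.asIdeal : FractionalIdeal (endOrder (Algebra.leftMulMatrix μ))⁰ K) / 𝔭.asIdeal :
              FractionalIdeal (endOrder (Algebra.leftMulMatrix μ))⁰ K) :
                Submodule (endOrder (Algebra.leftMulMatrix μ)) K))) = 1 := by
    intro 𝔭
    refine finrank_div_self_quotient_eq_one_of_isUnit_coeIdeal μ (asIdeal_ne_bot μ 𝔭) ?_
    by_contra hu
    obtain ⟨a, ha⟩ := (exists_not_isUnit_coeIdeal_iff μ).1 ⟨𝔭, hu⟩
    exact ha (hS a)
  simp only [h, ciSup_const]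

/-! ## §4 MAIN THEOREM 1 (3) in global form: `type(𝔯) ≤ [K:ℚ] − 1`, attained by `ℤ + p𝒪_K` -/

/-- **MAIN THEOREM 1 (3) / PROPOSITION 4.9, global form of the bound: `type(𝔯) = max_𝔭 type_𝔭(𝔯) ≤ [K:ℚ] − 1`** when
`[K:ℚ] = #ι ≥ 2` (prime by prime in `CMOrderCohenMacaulayTypeBound`). [cite: Marseglia2024CMType, §4 Prop. 4.9, p. 11;
§1 Main Theorem 1 (3), p. 3] -/
theorem iSup_finrank_traceDual_quotient_le_card_sub_one {T : FractionalIdeal (endOrder (Algebra.leftMulMatrix μ))⁰ K}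
    (hT : (T : Submodule (endOrder (Algebra.leftMulMatrix μ)) K) =
      traceDual ℤ ℚ ((1 : FractionalIdeal (endOrder (Algebra.leftMulMatrix μ))⁰ K) :
        Submodule (endOrder (Algebra.leftMulMatrix μ)) K))
    (h2 : 2 ≤ Fintype.card ι) :
    ⨆ 𝔭 : MaximalSpectrum (endOrder (Algebra.leftMulMatrix μ)),
        Module.finrank (endOrder (Algebra.leftMulMatrix μ) ⧸ 𝔭.asIdeal)
          ((T : Submodule (endOrder (Algebra.leftMulMatrix μ)) K) ⧸
            (𝔭.asIdeal • ⊤ : Submodule (endOrder (Algebra.leftMulMatrix μ))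
              (T : Submodule (endOrder (Algebra.leftMulMatrix μ)) K))) ≤ Fintype.card ι - 1 :=
  ciSup_le' fun 𝔭 ↦ finrank_traceDual_quotient_le_card_sub_one μ hT h2 (asIdeal_ne_bot μ 𝔭)

/-- **MAIN THEOREM 1 (3) / PROPOSITION 4.9, global form of the attainment: `type(ℤ + p𝒪_K) = [K:ℚ] − 1`** for the
order `𝔯 = ℤ + p𝒪_K` (`∀ x, x ∈ 𝔯 ↔ ∃ m y, x = m + p·y`) of a number field of degree `≥ 2` and a prime number `p`
(prime by prime in `CMOrderCohenMacaulayTypeAttained`: `[K:ℚ] − 1` at `p𝒪_K`, `1` elsewhere).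
[cite: Marseglia2024CMType, §4 Prop. 4.9 («the order `T = Z + p𝒪_K` satisfies `type(T) = dim_Q(K) − 1`»), pp. 11–12;
§1 Main Theorem 1 (3), p. 3] -/
theorem iSup_finrank_traceDual_quotient_eq_card_sub_one {p : ℕ} (hp : p.Prime) (h2 : 2 ≤ Fintype.card ι)
    (h𝔯 : ∀ x : K, x ∈ endOrder (Algebra.leftMulMatrix μ) ↔ ∃ (m : ℤ) (y : 𝓞 K), x = m + p * y)
    {T : FractionalIdeal (endOrder (Algebra.leftMulMatrix μ))⁰ K}
    (hT : (T : Submodule (endOrder (Algebra.leftMulMatrix μ)) K) =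
      traceDual ℤ ℚ ((1 : FractionalIdeal (endOrder (Algebra.leftMulMatrix μ))⁰ K) :
        Submodule (endOrder (Algebra.leftMulMatrix μ)) K)) :
    ⨆ 𝔭 : MaximalSpectrum (endOrder (Algebra.leftMulMatrix μ)),
        Module.finrank (endOrder (Algebra.leftMulMatrix μ) ⧸ 𝔭.asIdeal)
          ((T : Submodule (endOrder (Algebra.leftMulMatrix μ)) K) ⧸
            (𝔭.asIdeal • ⊤ : Submodule (endOrder (Algebra.leftMulMatrix μ))
              (T : Submodule (endOrder (Algebra.leftMulMatrix μ)) K))) = Fintype.card ι - 1 := by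
  obtain ⟨𝔭, h𝔭⟩ := exists_ideal_mem_iff μ h𝔯
  have hmax := isMaximal μ h𝔯 h𝔭 hp
  refine le_antisymm (iSup_finrank_traceDual_quotient_le_card_sub_one μ hT h2) ?_
  rw [← finrank_traceDual_quotient_eq_card_sub_one μ h𝔯 h𝔭 hp h2 hT]
  exact le_ciSup (bddAbove_range_finrank_traceDual_quotient μ hT) ⟨𝔭, hmax⟩

end CMTypeLattice

end Literature.NumberTheory.ComplexMultiplication
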